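import Summits.ResolutionOfSingularities.ResolutionOfSingularities.Theorems.EquisingularLiftEquisingularLiftNatNoLevel
import HarnessLib

/-!
# [OURS] A GENERAL-TAIL NEGATIVE THEOREM: every surface double point `y₂² + Ψ` with `Ψ ∈ (y)⁴` — tangent cone a double plane, NO cubic term — has NO
# finite blow-up depth in any blow-up tower (every field, arbitrary tail `Ψ`)
# (cruxes `Theses.EquisingularLift.EquisingularLiftNat` / `…NatThree` / `EquisingularLift`, stmt-ResolutionOfSingularities-20038 / -20148 / -15660)

[OURS · leafhand-res-equisingularlift-12 g1, 2026-09-01; cell `pub/decomp-res`] AI-produced, weaker than expert review; NOT a statement of any manuscript;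
nothing here proves resolution of singularities in positive characteristic.  DEF-FREE helper; no `sorry`; standard axioms; ZERO named hypotheses.

Unlike the normal-form certificates of the depth table, this statement needs NO normal form: for ANY `Ψ ∈ (y₀,y₁,y₂)⁴`, chart `1` of the blow-up of the
origin of `Spec K[y]/(y₂² + Ψ)` carries `T₂² + T₁²·R` (`Ψ(T₁T₀, T₁, T₁T₂) = T₁⁴·R`, ✓ `FirstOrderPoint.exists_aeval_subst_eq_pow_mul`), which lies in
`(T₁, T₂)²`: the strict transform is singular along the whole line `T₁ = T₂ = 0` of the exceptional divisor, and ✓ `towerLevel_none_origin_of_mem_sq`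
applies.  Examples: `Ẽ₇ = x² + y⁴ + z⁴`, `x² + y⁵ + z⁵`, `x² + (yz)² + y⁷ + …` — every double point whose 3-jet is `x²` (`Ẽ₈ = x² + y³ + z⁶` has a cubic
term; it is caught one blow-up later, ✓ `towerLevel_none_origin_x2y3zk`).

* ★★★ `OneStep.towerLevel_none_origin_sq_add_pow_four` — `Ψ ∈ (y)⁴` arbitrary ⟹ `∀ n, ¬ D n (Spec K[y₀,y₁,y₂]/(y₂² + Ψ)) (origin)`.

Honest consequence: in the classification «absolutely isolated double points = rational double points» this is the half «3-jet `x²` ⟹ not absolutely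
isolated», now in the route's tower currency with arbitrary tails.  Closes no registered stub.

References: [StacksProject, Tag 0804]; [Matsumura1987, Thm. 14.2]; [Lipman1969, §24]; through the cited tree files.
-/

set_option linter.dupNamespace false -- mandated namespace `Summit.<Summit>.<Problem>` of this single-conjunct summit

noncomputable section

open CategoryTheory CategoryTheory.Limits AlgebraicGeometry TopologicalSpace Topology
open MvPolynomial
open Literature.AlgebraicGeometry.Resolution
open AlgebraicGeometry.Scheme.IdealSheafData

namespace Summit.ResolutionOfSingularities.ResolutionOfSingularities.Cruxes.EquisingularLiftNat.Sections

namespace OneStep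

variable (K : Type) [Field K]

/-- ★★★ **DOUBLE POINTS WITH 3-JET `y₂²` HAVE NO BLOW-UP DEPTH**: for every `Ψ ∈ (y₀, y₁, y₂)⁴` and every blow-up tower `D`, the origin of
`Spec K[y₀,y₁,y₂]/(y₂² + Ψ)` has no `D`-level. [OURS] [cite: StacksProject, Tag 0804] [cite: Matsumura1987, Thm. 14.2] [cite: Lipman1969, §24] -/
theorem towerLevel_none_origin_sq_add_pow_four (D : ℕ → ∀ Γ : Scheme.{0}, Γ → Prop)
    (hD0 : ∀ (Γ : Scheme.{0}) (y : Γ), IsClosed (({y} : Set Γ)) →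
      (D 0 Γ y ↔ ∀ (hy : IsClosed (({y} : Set Γ))) (Z : Scheme.{0}) (τ : Z ⟶ Γ), IsBlowup τ (vanishingIdeal ⟨{y}, hy⟩) →
        ∀ z : Z, τ z = y → IsRegularLocalRing (Z.presheaf.stalk z)))
    (hDsucc : ∀ (d : ℕ) (Γ : Scheme.{0}) (y : Γ), IsClosed (({y} : Set Γ)) →
      (D (d + 1) Γ y ↔ ∀ (hy : IsClosed (({y} : Set Γ))) (Z : Scheme.{0}) (τ : Z ⟶ Γ), IsBlowup τ (vanishingIdeal ⟨{y}, hy⟩) →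
        ∃ S' : Finset Z, (∀ z : Z, τ z = y → z ∉ S' → IsRegularLocalRing (Z.presheaf.stalk z)) ∧
          ∀ z ∈ S', τ z = y ∧ IsClosed (({z} : Set Z)) ∧ ∃ d' ≤ d, D d' Z z))
    (Ψ : MvPolynomial (Fin 3) K) (hΨ : Ψ ∈ Ideal.span (Set.range (X : Fin 3 → MvPolynomial (Fin 3) K)) ^ 4)
    (y₀ : Spec (CommRingCat.of (MvPolynomial (Fin 3) K ⧸ Ideal.span {(X 2 ^ 2 : MvPolynomial (Fin 3) K) + Ψ})))
    (hy₀ : y₀.asIdeal = Ideal.map (Ideal.Quotient.mk (Ideal.span {(X 2 ^ 2 : MvPolynomial (Fin 3) K) + Ψ}))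
      (Ideal.span (Set.range (X : Fin 3 → MvPolynomial (Fin 3) K)))) (n : ℕ) :
    ¬ D n (Spec (CommRingCat.of (MvPolynomial (Fin 3) K ⧸ Ideal.span {(X 2 ^ 2 : MvPolynomial (Fin 3) K) + Ψ}))) y₀ := by
  classical
  have hΦ : (X 2 ^ 2 : MvPolynomial (Fin 3) K).IsHomogeneous 2 := isHomogeneous_X_pow (2 : Fin 3) 2
  have hΦ0 : (X 2 ^ 2 : MvPolynomial (Fin 3) K) ≠ 0 := pow_ne_zero _ (X_ne_zero 2)
  have hΨ3 : Ψ ∈ Ideal.span (Set.range (X : Fin 3 → MvPolynomial (Fin 3) K)) ^ (2 + 1) := Ideal.pow_le_pow_right (by norm_num) hΨ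
  -- chart `1`: `Ψ(T₁T₀, T₁, T₁T₂) = T₁⁴·R`, strict transform `T₂² + T₁²R`
  obtain ⟨R, hR⟩ := FirstOrderPoint.exists_aeval_subst_eq_pow_mul K 1 hΨ
  have hG : aeval (fun j => X 1 * Function.update (X : Fin 3 → MvPolynomial (Fin 3) K) 1 1 j) ((X 2 ^ 2 : MvPolynomial (Fin 3) K) + Ψ) =
      X 1 ^ 2 * (X 2 ^ 2 + X 1 ^ 2 * R) := by
    rw [map_add, hR, map_pow, aeval_X, Function.update_of_ne (by decide : (2 : Fin 3) ≠ 1)]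
    ring
  let P : Ideal (MvPolynomial (Fin 3) K) := Ideal.span (X '' ({1, 2} : Set (Fin 3)))
  haveI hP : P.IsPrime := Literature.RingTheory.MvPolynomial.isPrime_span_X_image _
  have hX1 : (X 1 : MvPolynomial (Fin 3) K) ∈ P := Literature.RingTheory.MvPolynomial.X_mem_span_X_image_iff.mpr (by simp)
  have hX2 : (X 2 : MvPolynomial (Fin 3) K) ∈ P := Literature.RingTheory.MvPolynomial.X_mem_span_X_image_iff.mpr (by simp)
  have hX0 : (X 0 : MvPolynomial (Fin 3) K) ∉ P := fun h =>
    absurd (Literature.RingTheory.MvPolynomial.X_mem_span_X_image_iff.mp h) (by simp)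
  have hPmax : ¬ P.IsMaximal := by
    intro hM
    let Q : Ideal (MvPolynomial (Fin 3) K) := Ideal.span (X '' (Set.univ : Set (Fin 3)))
    haveI hQ : Q.IsPrime := Literature.RingTheory.MvPolynomial.isPrime_span_X_image _
    have hPQ : P ≤ Q := Ideal.span_mono (Set.image_mono (Set.subset_univ _))
    have hEq : P = Q := hM.eq_of_le hQ.ne_top hPQ
    exact hX0 (hEq ▸ Literature.RingTheory.MvPolynomial.X_mem_span_X_image_iff.mpr (Set.mem_univ _))
  have hGP : (X 2 ^ 2 + X 1 ^ 2 * R : MvPolynomial (Fin 3) K) ∈ P ^ 2 :=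
    Ideal.add_mem _ (Ideal.pow_mem_pow hX2 2) (Ideal.mul_mem_right _ _ (Ideal.pow_mem_pow hX1 2))
  have hG0 : (X 2 ^ 2 + X 1 ^ 2 * R : MvPolynomial (Fin 3) K) ≠ 0 := by
    intro h
    have h1 := congrArg (eval (Pi.single (2 : Fin 3) (1 : K))) h
    simp at h1
  exact towerLevel_none_origin_of_mem_sq K D hD0 hDsucc (X 2 ^ 2) Ψ (by norm_num) hΦ hΦ0 hΨ3 1 _ hG0 hG P hPmax hX1 hGP y₀ hy₀ n

end OneStep

end Summit.ResolutionOfSingularities.ResolutionOfSingularities.Cruxes.EquisingularLiftNat.Sections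

end
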